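/-
Copyright (c) 2026. All rights reserved.
Released under Apache 2.0 license as described in the file LICENSE.
Authors: HodgeCM publication cell (pub-hodgecm), GR lane, seat GR-2 (`pub-hodgecm-own-hyp34`).
-/
import Literature.NumberTheory.GelbartRogawski1991.Prop311AsPrinted
import Mathlib.RingTheory.Flat.Basic
import HarnessLib

/-!
# [GelbartRogawski1991, §3.1]: the tacit inclusions `Sp_F(W) ⊆ Sp_𝐀(W)`, `G(𝐀) ⊆ Sp_𝐀(W)`, `G(F) ⊆ G(𝐀)` of the
# PRINTED objects of Prop. 3.1.1, as homomorphisms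

Topic `NumberTheory/GelbartRogawski1991`; namespace `Literature.NumberTheory.GelbartRogawski1991.Prop311` (the
namespace of the auxiliary objects of the statement-exact typing `Prop311AsPrinted`).  Definitions and proved
lemmas only; nothing of [GelbartRogawski1991] is asserted; `Prop311AsPrinted` is untouched.

[GelbartRogawski1991, §3.1 p. 454 L17–42, Prop. 3.1.1 p. 455 L1–2] use three inclusions without naming them:
"the group of `F`-rational points `Sp_F(W)`" of `Sp_𝐀(W)` (p. 454 L35–36); "`π` splits over `G(𝐀)`" for
`π : Mp_𝐀(W) → Sp_𝐀(W)`, i.e. `G(𝐀) ⊆ Sp_𝐀(W)` ("`W` coincides with `V`, but viewed as an `F`-vector space, and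
`φ = Tr_{E/F}(Φ)`", p. 454 L41–42); and "`s(G(F))`", `G(F) ⊆ G(𝐀)` (p. 455 L2).  The statement-exact typing
`Prop311AsPrinted` renders them pointwise (renderings R3, R5: `IsRationalSplitting`, `projEnd … = (g : W_𝐀 →ₗ W_𝐀)`,
`IsRationalPoint`).  This file supplies them as GROUP HOMOMORPHISMS on the printed objects, for use by the splitting
datum on the printed objects (`Prop311PrintedSplittingDatum.lean`):

* §1 `ratSpToAdelic : Sp_F(W) →* Sp_𝐀(W)`, `g₀ ↦ 1 ⊗ g₀` (`LinearEquiv.baseChange`; an isometry of `φ` base-changes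
  to an isometry of `φ_𝐀`, `baseChange_mem_isometries`), INJECTIVE (`𝐀` is faithfully flat over the field `F`),
  with `ratSpEquiv : Sp_F(W) ≃* range`;
* §2 **`G(𝐀) ≤ Sp_𝐀(W)`** (`adelicUnitary_le_adelicSp`, `adelicUnitaryToSp`): an `𝐀`-linear automorphism of `W_𝐀`
  preserving `Φ_𝐀 = Φ ⊗ 𝐀` preserves `φ_𝐀 = Tr_{E/F}(Φ) ⊗ 𝐀` because **`φ_𝐀 = (Tr ⊗ 𝐀) ∘ Φ_𝐀`**
  (`adelicTraceForm_eq_trace_adelicHermForm`), hence the commutator form `B_𝐀 - ᵗB_𝐀`, `B_𝐀 = ½ φ_𝐀`, of `H_𝐀(W)`;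
* §3 `ratUnitary Φ = U(V, Φ)(F)` (the `E`-linear `Φ`-isometries of `V`) and `ratUnitaryToAdelic : G(F) →* G(𝐀)`,
  `g₀ ↦ 1 ⊗ g₀`, whose range is EXACTLY print's "`g ∈ G(F)`": `γ ∈ range ↔ IsRationalPoint γ`
  (`mem_range_ratUnitaryToAdelic_iff`); and `ι(G(F)) ⊆ Sp_F(W)` (`adelicUnitaryToSp_ratUnitaryToAdelic`).

## References
* [GelbartRogawski1991] S. Gelbart, J. Rogawski, Invent. Math. 105 (1991) 445–472, §3.1 p. 454 L17–42, Prop. 3.1.1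
  p. 455 L1–2.
* [MoeglinVignerasWaldspurger1987] C. Mœglin, M.-F. Vignéras, J.-L. Waldspurger, LNM 1291 (1987), Chap. 1 I.17–I.19
  (unitary groups inside the symplectic group of the restriction of scalars).
-/

set_option autoImplicit false

noncomputable section

open NumberField
open scoped TensorProduct

namespace Literature.NumberTheory.GelbartRogawski1991

open Literature.RepresentationTheory.HeisenbergGroup

namespace Prop311

variable (F : Type) [Field F] [NumberField F]
variable (E : Type) [Field E] [Algebra F E]
variable (V : Type) [AddCommGroup V] [Module F V] [Module E V] [IsScalarTower F E V]
variable (Φ : V →ₗ[F] V →ₗ[F] E)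


/-! ## §1. Base change of isometries: `Sp_F(W) ⊆ Sp_𝐀(W)` -/

section BaseChange

omit [NumberField F] [Module E V] [IsScalarTower F E V] in
/-- an isometry of a bilinear form `B` on `V` base-changes to an isometry of `B ⊗ A` on `A ⊗_F V` (`g₀ ↦ 1 ⊗ g₀`).
[cite: GelbartRogawski1991, §3.1 p. 454 L35–36] -/
theorem baseChange_mem_isometries (A : Type*) [CommRing A] [Algebra F A] {B : LinearMap.BilinForm F V}
    {g : V ≃ₗ[F] V} (hg : g ∈ Heisenberg.PseudoSymplectic.isometries B) :
    g.baseChange F A V V ∈ Heisenberg.PseudoSymplectic.isometries (B.baseChange A) := by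
  rw [Heisenberg.PseudoSymplectic.mem_isometries] at hg ⊢
  intro x y
  induction x using TensorProduct.induction_on with
  | zero => simp only [map_zero, LinearMap.zero_apply]
  | tmul a m =>
    induction y using TensorProduct.induction_on with
    | zero => simp only [map_zero]
    | tmul b n => simp only [LinearEquiv.baseChange_tmul, LinearMap.BilinForm.baseChange_tmul, hg]
    | add y₁ y₂ h₁ h₂ => simp only [map_add, h₁, h₂]
  | add x₁ x₂ h₁ h₂ => simp only [map_add, LinearMap.add_apply, h₁, h₂]

omit [Module E V] [IsScalarTower F E V] in
/-- an `𝐀`-linear automorphism of `W_𝐀` preserving `φ_𝐀` lies in `Sp_𝐀(W)` (the isometry group of the commutator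
form of `H_𝐀(W)`, `B_𝐀 - ᵗB_𝐀` with `B_𝐀 = ½ φ_𝐀`; no alternation is needed). [cite: GelbartRogawski1991, §3.1 p. 454 L17–22] -/
theorem mem_adelicSp_of_forall_adelicTraceForm_eq {g : AdelicSpace F V ≃ₗ[AdeleRing (𝓞 F) F] AdelicSpace F V}
    (hg : ∀ x y : AdelicSpace F V,
      adelicTraceForm F E V Φ (g x) (g y) = adelicTraceForm F E V Φ x y) :
    g ∈ adelicSp F E V Φ := by
  rw [mem_symplecticGroup]
  intro w w'
  simp only [heisForm, LinearMap.smul_apply, hg]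

omit [Module E V] [IsScalarTower F E V] in
/-- **`Sp_F(W) → Sp_𝐀(W)`, `g₀ ↦ 1 ⊗ g₀`** (print's tacit inclusion of "the group of `F`-rational points `Sp_F(W)`"
in `Sp_𝐀(W)`). [cite: GelbartRogawski1991, §3.1 p. 454 L35–36] -/
def ratSpToAdelic : ratSp F E V Φ →* adelicSp F E V Φ where
  toFun g₀ := ⟨(g₀ : V ≃ₗ[F] V).baseChange F (AdeleRing (𝓞 F) F) V V,
    mem_adelicSp_of_forall_adelicTraceForm_eq F E V Φ fun x y =>
      (Heisenberg.PseudoSymplectic.mem_isometries _ _).1 (baseChange_mem_isometries F V (AdeleRing (𝓞 F) F) g₀.2) x y⟩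
  map_one' := Subtype.ext (LinearEquiv.baseChange_one F (AdeleRing (𝓞 F) F) V)
  map_mul' _ _ := Subtype.ext (LinearEquiv.baseChange_mul F (AdeleRing (𝓞 F) F) V _ _)

omit [Module E V] [IsScalarTower F E V] in
/-- formula: the underlying automorphism of `ratSpToAdelic g₀` is `1 ⊗ g₀`. [cite: GelbartRogawski1991, §3.1 p. 454 L35–36] -/
@[simp] theorem coe_ratSpToAdelic (g₀ : ratSp F E V Φ) :
    ((ratSpToAdelic F E V Φ g₀ : adelicSp F E V Φ) : AdelicSpace F V ≃ₗ[AdeleRing (𝓞 F) F] AdelicSpace F V) =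
      (g₀ : V ≃ₗ[F] V).baseChange F (AdeleRing (𝓞 F) F) V V := rfl

omit [Module E V] [IsScalarTower F E V] in
/-- as `𝐀`-linear maps, the `π`-coordinate of `ratSpToAdelic g₀` is `LinearMap.baseChange 𝐀 g₀` — the right-hand
side of `IsRationalSplitting`. [cite: GelbartRogawski1991, §3.1 p. 454 L35–36] -/
theorem coe_coe_ratSpToAdelic (g₀ : ratSp F E V Φ) :
    (((ratSpToAdelic F E V Φ g₀ : adelicSp F E V Φ) : AdelicSpace F V ≃ₗ[AdeleRing (𝓞 F) F] AdelicSpace F V) :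
        AdelicSpace F V →ₗ[AdeleRing (𝓞 F) F] AdelicSpace F V) =
      ((g₀ : V ≃ₗ[F] V) : V →ₗ[F] V).baseChange (AdeleRing (𝓞 F) F) := by
  rw [coe_ratSpToAdelic, LinearEquiv.coe_baseChange]

omit [Module E V] [IsScalarTower F E V] in
/-- `g₀ ↦ 1 ⊗ g₀` is injective on `GL(W)` (`𝐀` is faithfully flat over the field `F`).
[cite: GelbartRogawski1991, §3.1 p. 454 L35–36] -/
theorem baseChange_adeleRing_injective :
    Function.Injective fun g : V ≃ₗ[F] V => g.baseChange F (AdeleRing (𝓞 F) F) V V := by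
  intro g g' h
  haveI : FaithfulSMul F (AdeleRing (𝓞 F) F) :=
    (faithfulSMul_iff_algebraMap_injective F (AdeleRing (𝓞 F) F)).2 (AdeleRing.algebraMap_injective (𝓞 F) F)
  haveI : Module.Free F V := Module.Free.of_divisionRing F V
  apply LinearEquiv.toLinearMap_injective
  apply LinearMap.baseChangeHom_injective (R := F) (S := (AdeleRing (𝓞 F) F)) (M := V) (N := V)
  rw [LinearMap.baseChangeHom_apply, LinearMap.baseChangeHom_apply, ← LinearEquiv.coe_baseChange,
    ← LinearEquiv.coe_baseChange]
  exact congrArg (fun k : AdelicSpace F V ≃ₗ[AdeleRing (𝓞 F) F] AdelicSpace F V =>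
    (k : AdelicSpace F V →ₗ[AdeleRing (𝓞 F) F] AdelicSpace F V)) h

omit [Module E V] [IsScalarTower F E V] in
/-- `Sp_F(W) → Sp_𝐀(W)` is injective. [cite: GelbartRogawski1991, §3.1 p. 454 L35–36] -/
theorem ratSpToAdelic_injective : Function.Injective (ratSpToAdelic F E V Φ) := fun _ _ h =>
  Subtype.ext (baseChange_adeleRing_injective F V (congrArg (fun k : adelicSp F E V Φ =>
    (k : AdelicSpace F V ≃ₗ[AdeleRing (𝓞 F) F] AdelicSpace F V)) h))

omit [Module E V] [IsScalarTower F E V] in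
/-- **`Sp_F(W) ≃` its image in `Sp_𝐀(W)`.** [cite: GelbartRogawski1991, §3.1 p. 454 L35–36] -/
def ratSpEquiv : ratSp F E V Φ ≃* (ratSpToAdelic F E V Φ).range :=
  MonoidHom.ofInjective (ratSpToAdelic_injective F E V Φ)

omit [Module E V] [IsScalarTower F E V] in
/-- formula. [cite: GelbartRogawski1991, §3.1 p. 454 L35–36] -/
@[simp] theorem coe_ratSpEquiv (g₀ : ratSp F E V Φ) :
    ((ratSpEquiv F E V Φ g₀ : (ratSpToAdelic F E V Φ).range) : adelicSp F E V Φ) = ratSpToAdelic F E V Φ g₀ :=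
  rfl

omit [Module E V] [IsScalarTower F E V] in
/-- formula for the inverse: `ratSpToAdelic (ratSpEquiv⁻¹ y) = y`. [cite: GelbartRogawski1991, §3.1 p. 454 L35–36] -/
@[simp] theorem ratSpToAdelic_ratSpEquiv_symm (y : (ratSpToAdelic F E V Φ).range) :
    ratSpToAdelic F E V Φ ((ratSpEquiv F E V Φ).symm y) = (y : adelicSp F E V Φ) :=
  MonoidHom.apply_ofInjective_symm (ratSpToAdelic_injective F E V Φ) y

end BaseChange

/-! ## §2. `G(𝐀) ≤ Sp_𝐀(W)`: unitary for `Φ_𝐀` implies symplectic for `φ_𝐀 = Tr(Φ) ⊗ 𝐀` -/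

section Unitary

omit [Module E V] [IsScalarTower F E V] in
/-- **`φ_𝐀 = (Tr_{E/F} ⊗ 𝐀) ∘ Φ_𝐀`** on `W_𝐀 = 𝐀 ⊗_F V`: the base change of `φ = Tr_{E/F}(Φ)` is the trace (base
changed to `𝐀 ⊗_F E → 𝐀`) of the base change of `Φ`. [cite: GelbartRogawski1991, §3.1 p. 454 L40–42] -/
theorem adelicTraceForm_eq_trace_adelicHermForm (x y : AdelicSpace F V) :
    adelicTraceForm F E V Φ x y =
      TensorProduct.AlgebraTensorModule.rid F (AdeleRing (𝓞 F) F) (AdeleRing (𝓞 F) F)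
        ((Algebra.trace F E).baseChange (AdeleRing (𝓞 F) F) (adelicHermForm F E V Φ x y)) := by
  induction x using TensorProduct.induction_on with
  | zero => simp only [map_zero, LinearMap.zero_apply]
  | tmul a m =>
    induction y using TensorProduct.induction_on with
    | zero => simp only [map_zero]
    | tmul b n =>
      simp only [adelicTraceForm, adelicHermForm, LinearMap.BilinForm.baseChange_tmul,
        LinearMap.BilinMap.baseChange_tmul, LinearMap.baseChange_tmul, traceForm_apply,
        TensorProduct.AlgebraTensorModule.rid_tmul]
    | add y₁ y₂ h₁ h₂ => simp only [map_add, h₁, h₂]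
  | add x₁ x₂ h₁ h₂ => simp only [map_add, LinearMap.add_apply, h₁, h₂]

/-- an element of `G(𝐀)` preserves `φ_𝐀`. [cite: GelbartRogawski1991, §3.1 p. 454 L37–42] -/
theorem adelicTraceForm_apply_apply_of_mem_adelicUnitary
    {g : AdelicSpace F V ≃ₗ[AdeleRing (𝓞 F) F] AdelicSpace F V} (hg : g ∈ adelicUnitary F E V Φ) (x y : AdelicSpace F V) :
    adelicTraceForm F E V Φ (g x) (g y) = adelicTraceForm F E V Φ x y := by
  rw [adelicTraceForm_eq_trace_adelicHermForm, adelicTraceForm_eq_trace_adelicHermForm, hg.2]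

/-- **`G(𝐀) ≤ Sp_𝐀(W)`** inside `GL(W_𝐀)`: the unitary group of `(V_𝐀, Φ_𝐀)` is contained in the symplectic group of
`(W_𝐀, φ_𝐀)` (print's tacit embedding in "the covering `π` splits over `G(𝐀)`", `π : Mp_𝐀(W) → Sp_𝐀(W)`).
[cite: GelbartRogawski1991, §3.1 p. 454 L37–42, Prop. 3.1.1 p. 455 L1] -/
theorem adelicUnitary_le_adelicSp : adelicUnitary F E V Φ ≤ adelicSp F E V Φ := fun _ hg =>
  mem_adelicSp_of_forall_adelicTraceForm_eq F E V Φ (adelicTraceForm_apply_apply_of_mem_adelicUnitary F E V Φ hg)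

/-- **`ι : G(𝐀) →* Sp_𝐀(W)`**, the inclusion. [cite: GelbartRogawski1991, §3.1 p. 454 L37–42, Prop. 3.1.1 p. 455 L1] -/
def adelicUnitaryToSp : adelicUnitary F E V Φ →* adelicSp F E V Φ :=
  Subgroup.inclusion (adelicUnitary_le_adelicSp F E V Φ)

/-- `ι g` has the same underlying automorphism as `g`. [cite: GelbartRogawski1991, §3.1 p. 454 L37–42] -/
@[simp] theorem coe_adelicUnitaryToSp (g : adelicUnitary F E V Φ) :
    ((adelicUnitaryToSp F E V Φ g : adelicSp F E V Φ) : AdelicSpace F V ≃ₗ[AdeleRing (𝓞 F) F] AdelicSpace F V) =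
      (g : AdelicSpace F V ≃ₗ[AdeleRing (𝓞 F) F] AdelicSpace F V) := rfl

/-- `ι` is continuous for the printed topologies (pointwise convergence on `W_𝐀` on both groups, through
`Sp_𝐀(W) ≤ GL(W_𝐀)`): every coordinate `g ↦ (ι g) w` is the coordinate `g ↦ g w`.
[cite: GelbartRogawski1991, Prop. 3.1.1 p. 455 L1–2] -/
theorem continuous_adelicUnitaryToSp_apply (w : AdelicSpace F V) :
    @Continuous (adelicUnitary F E V Φ) (AdelicSpace F V) _ (adelicSpaceTopology F V)
      fun g => ((adelicUnitaryToSp F E V Φ g : adelicSp F E V Φ) :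
        AdelicSpace F V ≃ₗ[AdeleRing (𝓞 F) F] AdelicSpace F V) w := by
  letI := adelicSpaceTopology F V
  exact continuous_iInf_dom (i := w) continuous_induced_dom

end Unitary

/-! ## §3. `G(F) ⊆ G(𝐀)`: the rational unitary group and print's "`g ∈ G(F)`" -/

section Rational

omit [NumberField F] [IsScalarTower F E V] in
/-- **`G(F) = U(V, Φ)(F)`**: the `E`-linear automorphisms `g₀` of `V` with `Φ(g₀ x, g₀ y) = Φ(x, y)` (the group whose
elements are the `g₀` of `IsRationalPoint`). [cite: GelbartRogawski1991, §3.1 p. 454 L37–38, Prop. 3.1.1 p. 455 L2] -/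
def ratUnitary : Subgroup (V ≃ₗ[E] V) where
  carrier := {g₀ | ∀ x y : V, Φ (g₀ x) (g₀ y) = Φ x y}
  mul_mem' := by
    intro g g' hg hg' x y
    simp only [Set.mem_setOf_eq] at hg hg'
    rw [LinearEquiv.mul_apply, LinearEquiv.mul_apply, hg, hg']
  one_mem' := fun _ _ => rfl
  inv_mem' := by
    intro g hg x y
    simp only [Set.mem_setOf_eq] at hg
    have h := hg (g⁻¹ x) (g⁻¹ y)
    simp only [LinearEquiv.coe_inv, LinearEquiv.apply_symm_apply] at h
    simpa only [LinearEquiv.coe_inv] using h.symm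

omit [NumberField F] [IsScalarTower F E V] in
/-- membership in `G(F)`. [cite: GelbartRogawski1991, §3.1 p. 454 L37–38] -/
@[simp] theorem mem_ratUnitary (g₀ : V ≃ₗ[E] V) :
    g₀ ∈ ratUnitary F E V Φ ↔ ∀ x y : V, Φ (g₀ x) (g₀ y) = Φ x y := Iff.rfl

omit [NumberField F] in
/-- `1 ⊗ g₀` commutes with the scalar action `1 ⊗ (e • ·)` of `E` on `A ⊗_F V` for `E`-linear `g₀`.
[cite: GelbartRogawski1991, §3.1 p. 454 L37–41] -/
theorem baseChange_restrictScalars_lsmul (A : Type*) [CommRing A] [Algebra F A] (g₀ : V ≃ₗ[E] V) (e : E)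
    (x : A ⊗[F] V) :
    (g₀.restrictScalars F).baseChange F A V V (((LinearMap.lsmul E V e).restrictScalars F).baseChange A x) =
      ((LinearMap.lsmul E V e).restrictScalars F).baseChange A ((g₀.restrictScalars F).baseChange F A V V x) := by
  induction x using TensorProduct.induction_on with
  | zero => simp only [map_zero]
  | tmul a m =>
    simp only [LinearMap.baseChange_tmul, LinearEquiv.baseChange_tmul, LinearMap.restrictScalars_apply,
      LinearMap.lsmul_apply, LinearEquiv.restrictScalars_apply, map_smul]
  | add x₁ x₂ h₁ h₂ => simp only [map_add, h₁, h₂]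

/-- `1 ⊗ g₀` preserves `Φ_𝐀 = Φ ⊗ 𝐀` for a `Φ`-isometry `g₀`. [cite: GelbartRogawski1991, §3.1 p. 454 L37–38] -/
theorem adelicHermForm_baseChange_restrictScalars {g₀ : V ≃ₗ[E] V} (hg₀ : g₀ ∈ ratUnitary F E V Φ)
    (x y : AdelicSpace F V) :
    adelicHermForm F E V Φ ((g₀.restrictScalars F).baseChange F (AdeleRing (𝓞 F) F) V V x)
        ((g₀.restrictScalars F).baseChange F (AdeleRing (𝓞 F) F) V V y) =
      adelicHermForm F E V Φ x y := by
  rw [mem_ratUnitary] at hg₀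
  induction x using TensorProduct.induction_on with
  | zero => simp only [map_zero, LinearMap.zero_apply]
  | tmul a m =>
    induction y using TensorProduct.induction_on with
    | zero => simp only [map_zero]
    | tmul b n =>
      simp only [adelicHermForm, LinearEquiv.baseChange_tmul, LinearEquiv.restrictScalars_apply,
        LinearMap.BilinMap.baseChange_tmul, hg₀]
    | add y₁ y₂ h₁ h₂ => simp only [map_add, h₁, h₂]
  | add x₁ x₂ h₁ h₂ => simp only [map_add, LinearMap.add_apply, h₁, h₂]

/-- `1 ⊗ g₀ ∈ G(𝐀)` for `g₀ ∈ G(F)`. [cite: GelbartRogawski1991, §3.1 p. 454 L37–38, Prop. 3.1.1 p. 455 L2] -/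
theorem baseChange_restrictScalars_mem_adelicUnitary {g₀ : V ≃ₗ[E] V} (hg₀ : g₀ ∈ ratUnitary F E V Φ) :
    (g₀.restrictScalars F).baseChange F (AdeleRing (𝓞 F) F) V V ∈ adelicUnitary F E V Φ :=
  ⟨fun e x => baseChange_restrictScalars_lsmul F E V (AdeleRing (𝓞 F) F) g₀ e x,
    adelicHermForm_baseChange_restrictScalars F E V Φ hg₀⟩

omit [NumberField F] in
/-- restriction of scalars `E → F` on `GL(V)` is multiplicative. [cite: GelbartRogawski1991, §3.1 p. 454 L41] -/
theorem restrictScalars_mul (g g' : V ≃ₗ[E] V) :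
    (g * g').restrictScalars F = g.restrictScalars F * g'.restrictScalars F :=
  LinearEquiv.ext fun _ => rfl

omit [NumberField F] in
/-- restriction of scalars `E → F` on `GL(V)` preserves `1`. [cite: GelbartRogawski1991, §3.1 p. 454 L41] -/
theorem restrictScalars_one : (1 : V ≃ₗ[E] V).restrictScalars F = 1 :=
  LinearEquiv.ext fun _ => rfl

/-- **`G(F) → G(𝐀)`, `g₀ ↦ 1 ⊗ g₀`** (the diagonal embedding of the rational points of the unitary group).
[cite: GelbartRogawski1991, §3.1 p. 454 L37–38, Prop. 3.1.1 p. 455 L2] -/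
def ratUnitaryToAdelic : ratUnitary F E V Φ →* adelicUnitary F E V Φ where
  toFun g₀ := ⟨((g₀ : V ≃ₗ[E] V).restrictScalars F).baseChange F (AdeleRing (𝓞 F) F) V V,
    baseChange_restrictScalars_mem_adelicUnitary F E V Φ g₀.2⟩
  map_one' := Subtype.ext (by
    show ((1 : V ≃ₗ[E] V).restrictScalars F).baseChange F (AdeleRing (𝓞 F) F) V V = 1
    rw [restrictScalars_one, LinearEquiv.baseChange_one])
  map_mul' g g' := Subtype.ext (by
    show (((g : V ≃ₗ[E] V) * (g' : V ≃ₗ[E] V)).restrictScalars F).baseChange F (AdeleRing (𝓞 F) F) V V =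
      ((g : V ≃ₗ[E] V).restrictScalars F).baseChange F (AdeleRing (𝓞 F) F) V V *
        ((g' : V ≃ₗ[E] V).restrictScalars F).baseChange F (AdeleRing (𝓞 F) F) V V
    rw [restrictScalars_mul, LinearEquiv.baseChange_mul])

/-- formula: the underlying automorphism of `ratUnitaryToAdelic g₀` is `1 ⊗ g₀`. [cite: GelbartRogawski1991, Prop. 3.1.1 p. 455 L2] -/
@[simp] theorem coe_ratUnitaryToAdelic (g₀ : ratUnitary F E V Φ) :
    ((ratUnitaryToAdelic F E V Φ g₀ : adelicUnitary F E V Φ) : AdelicSpace F V ≃ₗ[AdeleRing (𝓞 F) F] AdelicSpace F V) =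
      ((g₀ : V ≃ₗ[E] V).restrictScalars F).baseChange F (AdeleRing (𝓞 F) F) V V := rfl

/-- as `𝐀`-linear maps, `ratUnitaryToAdelic g₀` is the right-hand side of `IsRationalPoint`.
[cite: GelbartRogawski1991, Prop. 3.1.1 p. 455 L2] -/
theorem coe_coe_ratUnitaryToAdelic (g₀ : ratUnitary F E V Φ) :
    (((ratUnitaryToAdelic F E V Φ g₀ : adelicUnitary F E V Φ) : AdelicSpace F V ≃ₗ[AdeleRing (𝓞 F) F] AdelicSpace F V) :
        AdelicSpace F V →ₗ[AdeleRing (𝓞 F) F] AdelicSpace F V) =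
      (((g₀ : V ≃ₗ[E] V) : V →ₗ[E] V).restrictScalars F).baseChange (AdeleRing (𝓞 F) F) := by
  rw [coe_ratUnitaryToAdelic, LinearEquiv.coe_baseChange]
  rfl

/-- **print's "`g ∈ G(F)`" IS membership in the range of `G(F) → G(𝐀)`**: `γ ∈ range ↔ IsRationalPoint γ`.
[cite: GelbartRogawski1991, Prop. 3.1.1 p. 455 L2] -/
theorem mem_range_ratUnitaryToAdelic_iff (γ : adelicUnitary F E V Φ) :
    γ ∈ (ratUnitaryToAdelic F E V Φ).range ↔
      IsRationalPoint F E V Φ (γ : AdelicSpace F V ≃ₗ[AdeleRing (𝓞 F) F] AdelicSpace F V) := by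
  constructor
  · rintro ⟨g₀, rfl⟩
    exact ⟨g₀, g₀.2, coe_coe_ratUnitaryToAdelic F E V Φ g₀⟩
  · rintro ⟨g₀, hg₀, hγ⟩
    refine ⟨⟨g₀, hg₀⟩, Subtype.ext (LinearEquiv.toLinearMap_injective ?_)⟩
    rw [coe_coe_ratUnitaryToAdelic]
    exact hγ.symm

omit [NumberField F] in
/-- an `E`-linear `Φ`-isometry is an `F`-linear `φ`-isometry, `φ = Tr_{E/F}(Φ)`: `G(F) ⊆ Sp_F(W)` at the rational
level. [cite: GelbartRogawski1991, §3.1 p. 454 L37–42] -/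
theorem restrictScalars_mem_ratSp {g₀ : V ≃ₗ[E] V} (hg₀ : g₀ ∈ ratUnitary F E V Φ) :
    g₀.restrictScalars F ∈ ratSp F E V Φ := by
  rw [mem_ratSp]
  intro x y
  rw [mem_ratUnitary] at hg₀
  simp only [traceForm_apply, LinearEquiv.restrictScalars_apply, hg₀]

/-- `G(F) →* Sp_F(W)`, `g₀ ↦ g₀|_F` (restriction of scalars on the rational points).
[cite: GelbartRogawski1991, §3.1 p. 454 L37–42] -/
def ratUnitaryToRatSp : ratUnitary F E V Φ →* ratSp F E V Φ where
  toFun g₀ := ⟨(g₀ : V ≃ₗ[E] V).restrictScalars F, restrictScalars_mem_ratSp F E V Φ g₀.2⟩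
  map_one' := Subtype.ext (restrictScalars_one F E V)
  map_mul' _ _ := Subtype.ext (restrictScalars_mul F E V _ _)

/-- **`ι(G(F)) ⊆ Sp_F(W)`**: `ι (1 ⊗ g₀) = 1 ⊗ (g₀|_F)` — the square `G(F) → G(𝐀) → Sp_𝐀(W)` =
`G(F) → Sp_F(W) → Sp_𝐀(W)` commutes. [cite: GelbartRogawski1991, §3.1 p. 454 L35–42, Prop. 3.1.1 p. 455 L2] -/
theorem adelicUnitaryToSp_ratUnitaryToAdelic (g₀ : ratUnitary F E V Φ) :
    adelicUnitaryToSp F E V Φ (ratUnitaryToAdelic F E V Φ g₀) =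
      ratSpToAdelic F E V Φ (ratUnitaryToRatSp F E V Φ g₀) :=
  Subtype.ext rfl

/-- hence `ι γ ∈ range (Sp_F(W) → Sp_𝐀(W))` for `γ` in the range of `G(F) → G(𝐀)`.
[cite: GelbartRogawski1991, §3.1 p. 454 L35–42, Prop. 3.1.1 p. 455 L2] -/
theorem adelicUnitaryToSp_mem_range {γ : adelicUnitary F E V Φ} (hγ : γ ∈ (ratUnitaryToAdelic F E V Φ).range) :
    adelicUnitaryToSp F E V Φ γ ∈ (ratSpToAdelic F E V Φ).range := by
  obtain ⟨g₀, rfl⟩ := hγ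
  exact ⟨_, (adelicUnitaryToSp_ratUnitaryToAdelic F E V Φ g₀).symm⟩

end Rational

end Prop311

end Literature.NumberTheory.GelbartRogawski1991

end
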